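import Summits.ABC.IUTFork.Thm311Pilot
import Summits.ABC.IUTFork.ForkRegions
import Mathlib.Algebra.FiniteSupport.Basic
import HarnessLib

/-!
# [IUTchIII] Theorem 3.11 in the author's terms, H: bridge from the pilot nouns to the skeleton's `Cor312Setting`

Record-only file (D-0012) of the abc-iut cell (seat abc-iut-c312-1); TAKES NO SIDE. The fork skeleton's
`ForkRegions.Cor312Setting` (abc-iut-skel, XVII) types Corollary 3.12's nouns for ONE volume container:
possible images `U_λ`, the `q`-pilot image `Q`, a monotone log-volume, a hull; `Cor312Setting.Cor312` is
`−|log(q)| ≤ −|log(Θ)|` there. `Thm311Pilot.PilotNouns` (G) carries the same nouns in the author's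
indexing — one component per `(j, v_ℚ)`, `j ∈ F_l^⋇`, `v_ℚ ∈ V_ℚ`, over the typed situation of Theorem 3.11 —
and the author's AGGREGATE `−|log(Θ)|`, `−|log(q)|` ("procession-normalized": average over `j ∈ F_l^⋇`;
"global": sum over `v_ℚ`, Prop. 3.9 (iii)). This file:

* `PilotNouns.toCor312Setting`: each component `(n, m, j, v_ℚ)` IS a `Cor312Setting` (given the
  admissibility data the skeleton's structure asks for, bundled as `ComponentAdm`), with possible images
  indexed by `possibleImages n m j v_ℚ`, `−|log(Θ)|`-of-the-component = `μ^log(Uhol)` and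
  `−|log(q)|`-of-the-component = `μ^log(qRegion)` (`toCor312Setting_negLogTheta`, `_negAbsLogq`);
* `cor312At_of_componentwise`: BOOKKEEPING — if the skeleton's `Cor312` holds in every component (and both
  aggregate log-volumes are honest finite sums, `NegLogThetaReal`/`NegLogQReal`) then the author's aggregate
  inequality `Cor312At` holds; `negLogQReal_of_componentwise` supplies the `q`-side guard. The converse
  is not claimed (an average can dominate without every component dominating).

[claim: Mochizuki2012, status: disputed] [cite: DupuyHilado2025, §1 pp. 3–4] [cite: LANA2026Report, §8.1 pp. 40–41]
Deliberately NOT here: which reading of Step (xi) supplies `Cor312` (the skeleton's `RepresentedVol` /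
`QSubHull` / `QIsImage`, abc-iut-c312-2's chain); any judgement.
-/

noncomputable section

namespace Summit.ABC

namespace IUTFork

namespace Thm311

namespace PilotNouns

variable {T : ThetaIndex} {S : LatticeSituation T} (P : PilotNouns S)

/-- The admissibility data `ForkRegions.Cor312Setting` requires of one component `(n, m, j, v_ℚ)`: the
log-volume of (i) (a) is monotone on admissible regions of this packet (Prop. 3.9 (i)/(ii): a log-volume of
a measure), every possible image is admissible, the hull of their union is admissible ("`−|log(Θ)| ∈ ℝ`"),
and the `q`-pilot region is admissible. HYPOTHESIS structure. [claim: Mochizuki2012, status: disputed] -/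
structure ComponentAdm (n m : ℤ) (j : T.LabelStar) (vQ : T.VQ) : Prop where
  /-- monotonicity of `μ^log` on admissible regions of `I^ℚ(^{S^±_{j+1}};^{n,∘}D⊢_{v_ℚ})` -/
  mono : ∀ ⦃A B : Set (S.L.Packet j.1 vQ)⦄, (S.D n).Adm j.1 vQ A → (S.D n).Adm j.1 vQ B → A ⊆ B →
    (S.D n).logvol j.1 vQ A ≤ (S.D n).logvol j.1 vQ B
  /-- every possible image is admissible -/
  U_adm : ∀ R ∈ P.possibleImages n m j vQ, (S.D n).Adm j.1 vQ R
  /-- the hull of the union of the possible images is admissible -/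
  Uhol_adm : (S.D n).Adm j.1 vQ (P.Uhol n m j vQ)
  /-- the `q`-pilot region is admissible -/
  Q_adm : (S.D n).Adm j.1 vQ (P.qRegion n m j vQ)

/-- **Each component of the author's nouns is a `Cor312Setting` of the skeleton**: container = the packet
`I^ℚ(^{S^±_{j+1}};^{n,∘}D⊢_{v_ℚ})` with the mono-analytic log-volume of Thm. 3.11 (i) (a) and the holomorphic hull
of Rmk. 3.9.5 (i); possible images = `possibleImages n m j v_ℚ` (the (Ind1),(Ind2)-orbit of the
(Ind3)-enlarged Θ-pilot region); `Q` = the `q`-pilot region. [claim: Mochizuki2012, status: disputed] -/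
def toCor312Setting (n m : ℤ) (j : T.LabelStar) (vQ : T.VQ) (h : P.ComponentAdm n m j vQ) :
    Cor312Setting where
  L := S.L.Packet j.1 vQ
  Adm := (S.D n).Adm j.1 vQ
  logvol := (S.D n).logvol j.1 vQ
  logvol_mono := h.mono
  hull := P.hull n j.1 vQ
  Idx := P.possibleImages n m j vQ
  U := fun R => R.1
  U_adm := fun R => h.U_adm R.1 R.2
  Uhol_adm := by
    have : (⋃ R : P.possibleImages n m j vQ, (R.1 : Set (S.L.Packet j.1 vQ))) = ⋃₀ P.possibleImages n m j vQ :=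
      (Set.sUnion_eq_iUnion).symm
    rw [this]
    exact h.Uhol_adm
  Q := P.qRegion n m j vQ
  Q_adm := h.Q_adm

/-- The component setting's `−|log(Θ)|` is the log-volume of the author's `Uhol` at that component.
[folklore] -/
theorem toCor312Setting_negLogTheta (n m : ℤ) (j : T.LabelStar) (vQ : T.VQ) (h : P.ComponentAdm n m j vQ) :
    (P.toCor312Setting n m j vQ h).negLogTheta = (S.D n).logvol j.1 vQ (P.Uhol n m j vQ) := by
  show (S.D n).logvol j.1 vQ (P.hull n j.1 vQ (⋃ R : P.possibleImages n m j vQ, R.1)) = _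
  rw [← Set.sUnion_eq_iUnion]
  rfl

/-- The component setting's `−|log(q)|` is the log-volume of the author's `q`-pilot region. [folklore] -/
theorem toCor312Setting_negAbsLogq (n m : ℤ) (j : T.LabelStar) (vQ : T.VQ) (h : P.ComponentAdm n m j vQ) :
    (P.toCor312Setting n m j vQ h).negAbsLogq = (S.D n).logvol j.1 vQ (P.qRegion n m j vQ) := rfl

/-- **BOOKKEEPING: componentwise `Cor312` implies the aggregate inequality.** If in every component
`(j, v_ℚ)` the skeleton's `Cor312` holds (`μ^log(qRegion) ≤ μ^log(Uhol)`), `−|log(Θ)| ∈ ℝ`, and the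
`q`-side has finite support in `v_ℚ` at each `j`, then the author's procession-normalized, global
inequality `−|log(q)| ≤ −|log(Θ)|` (`Cor312At`) holds. [folklore] -/
theorem cor312At_of_componentwise (n m : ℤ) (h : ∀ (j : T.LabelStar) (vQ : T.VQ), P.ComponentAdm n m j vQ)
    (hreal : P.NegLogThetaReal n m) (hqreal : P.NegLogQReal n m)
    (hcomp : ∀ (j : T.LabelStar) (vQ : T.VQ), (P.toCor312Setting n m j vQ (h j vQ)).Cor312) :
    P.Cor312At n m := by
  refine ⟨hreal, hqreal, ?_⟩
  unfold negLogQ negLogTheta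
  have hl : (0 : ℝ) ≤ 1 / (T.lstar : ℝ) := by positivity
  refine mul_le_mul_of_nonneg_left ?_ hl
  have hθ : ∀ j : T.LabelStar,
      Function.HasFiniteSupport fun vQ => (S.D n).logvol j.1 vQ (P.Uhol n m j vQ) := by
    intro j
    refine (hreal.2.image Prod.snd).subset ?_
    intro vQ hvQ
    exact ⟨(j, vQ), hvQ, rfl⟩
  have hq : ∀ j : T.LabelStar,
      Function.HasFiniteSupport fun vQ => (S.D n).logvol j.1 vQ (P.qRegion n m j vQ) := by
    intro j
    refine (hqreal.2.image Prod.snd).subset ?_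
    intro vQ hvQ
    exact ⟨(j, vQ), hvQ, rfl⟩
  refine finsum_le_finsum' (Set.toFinite _) (Set.toFinite _) fun j => ?_
  refine finsum_le_finsum' (hq j) (hθ j) fun vQ => ?_
  have := hcomp j vQ
  unfold Cor312Setting.Cor312 at this
  rwa [toCor312Setting_negLogTheta, toCor312Setting_negAbsLogq] at this

/-- The `q`-side guard comes for free from componentwise admissibility plus finite support per label.
[folklore] -/
theorem negLogQReal_of_componentwise (n m : ℤ) (h : ∀ (j : T.LabelStar) (vQ : T.VQ), P.ComponentAdm n m j vQ)
    (hq : ∀ j : T.LabelStar, Function.HasFiniteSupport fun vQ => (S.D n).logvol j.1 vQ (P.qRegion n m j vQ)) :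
    P.NegLogQReal n m := by
  refine ⟨fun j vQ => (h j vQ).Q_adm, ?_⟩
  have : {p : T.LabelStar × T.VQ | (S.D n).logvol p.1.1 p.2 (P.qRegion n m p.1 p.2) ≠ 0} ⊆
      ⋃ j : T.LabelStar, (fun vQ => (j, vQ)) '' Function.support
        (fun vQ => (S.D n).logvol j.1 vQ (P.qRegion n m j vQ)) := by
    rintro ⟨j, vQ⟩ hp
    exact Set.mem_iUnion.2 ⟨j, vQ, hp, rfl⟩
  exact (Set.finite_iUnion fun j => (hq j).image _).subset this

/-- Under `LogvolIndInvariant` (all possible images have ONE log-volume, `logvol_eq_of_mem_possibleImages`),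
the skeleton's Reading 1 `RepresentedVol` ("the `q`-pilot log-volume is one of the possible values",
LANA §8.3) for the component setting says exactly: the (Ind3)-enlarged Θ-pilot region and the `q`-pilot
region have the same log-volume at `(j, v_ℚ)`. [folklore] -/
theorem representedVol_iff (n m : ℤ) (j : T.LabelStar) (vQ : T.VQ) (h : P.ComponentAdm n m j vQ)
    (hinv : S.LogvolIndInvariant n j vQ) (hadm : (S.D n).Adm j.1 vQ (P.thetaRegion3 n m j vQ)) :
    (P.toCor312Setting n m j vQ h).RepresentedVol ↔
      (S.D n).logvol j.1 vQ (P.thetaRegion3 n m j vQ) = (S.D n).logvol j.1 vQ (P.qRegion n m j vQ) := by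
  constructor
  · rintro ⟨R, hR⟩
    rw [← (P.logvol_eq_of_mem_possibleImages hinv hadm R.2).2]
    exact hR
  · intro hq
    exact ⟨⟨P.thetaRegion3 n m j vQ, P.thetaRegion3_mem_possibleImages n m j vQ⟩, hq⟩

end PilotNouns

end Thm311

end IUTFork

end Summit.ABC

end
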